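import Literature.NumberTheory.ConnesConsani2021.ProlateProjectionsProofs
import Literature.NumberTheory.ConnesConsani2021.SeriesRemainderBounds
import Mathlib.Analysis.SpecificLimits.Normed
import HarnessLib

/-!
# Osipov's explicit upper bound for the prolate eigenvalues `λ_n(c)` at fixed band-limit

RH-FREE (label, line 1).  Source: A. Osipov, *Certain upper bounds on the eigenvalues associated with
prolate spheroidal wave functions*, Appl. Comput. Harmon. Anal. 35 (2013) 309–340 = arXiv:1206.4541
[cite: Osipov2013, Thm. 33 (arXiv chunk p0018:L158–L175; proof p0018:L177–p0019:L17)]; the inputs it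
quotes by name (its Thms 6–9: `χ_n` versus `c²`, `n < (2/π)√χ_n E(c/√χ_n) < n+3`, `χ_n < (π(n+1)/2)²`,
`1/|ψ_n(0)| ≤ 4√(nχ_n/c²)` for even `n`) are proved in A. Osipov, *Certain inequalities involving prolate
spheroidal wave functions and associated quantities*, arXiv:1206.4056 = Yale CS TR-1449 (2012)
[cite: Osipov2012Inequalities, Thms. quoted as "[Report], [ReportArxiv]" in Osipov2013 §2.1 (chunk p0005:L84–L85)].

## What is typed, and why (cell rh-crit, cc-lead R64 (2))

Connes–Consani 2021 §4 display (rapid-decay) bounds CC's `λ(n)` (`= λ_{2n}^{2π}`) by Rokhlin–Xiao's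
`ν(2n, 2π)`; that bound (`CC2021_sec4_rapidDecay`, now ⇔ its first clause by
`CC2021_sec4_rapidDecay_iff_abs_le`) rests in print on an unproved expansion (RX07 (67)) and is
conjecture-class for the cell.  The PROVED-in-print substitute is Osipov's Theorem 33: for `c > 0` and
`n > 2c/π + √42`,
`|λ_n| < 1195 · c · x_n^{3/4} (x_n − 1)^{1/4} (x_n − ½)³ · exp[−(π/4)(√x_n − 1/√x_n) c]`, `x_n = χ_n/c²`
(`χ_n` the Sturm–Liouville eigenvalue of `ψ_n`).  Its printed proof invokes Osipov's Thm 9 and Thm 23,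
both stated for EVEN `n`; the fact below therefore carries `Even n` (cc-t8 06:48:40Z caveat) — harmless
for CC, whose index is `2n`.

VOCABULARY (tree, `c = 2π`, i.e. `λ = 1`): Osipov's `F_c[φ](x) = ∫_{−1}^{1} φ(t)e^{icxt}dt` (§2.1,
chunk p0004:L20–L33) is, at `c = 2π`, the kernel `e^{2πixt}` of `CC2021_sec4_cosalphan`; his `ψ_n` is
"the" continuous solution on `[−1,1]` of `(1−x²)ψ″ − 2xψ′ + (χ_n − c²x²)ψ = 0` (Thm 3, p0004:L177–L191)
with exactly `n` roots in `(−1,1)` (Thm 1, p0004:L51–L58), i.e. — up to a scalar, which the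
eigen-relations do not see — a tree prolate function `f` with `IsProlateFunction 1 n f` (the operator
`−∂((1−x²)∂) + (2πx)²` of `IsProlateFunction.eigen` at `λ = 1` is Osipov's ODE with `c = 2π` and the
same `χ`), and `λ_n` is the eigenvalue in `∫_{−1}^{1} ψ_n(t)e^{icxt}dt = λ_n ψ_n(x)` (p0004:L30–L33).
The fact is typed at `c = 2π` over `IsProlateFunction 1 n f`, with the two eigen-relations as
hypotheses (exactly as `Wang2010_lemma_2_2` is typed).
-- TODO(general form): arbitrary band-limit `c > 0` (tree: `IsProlateFunction lam n f`, `c = 2πλ²`,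
-- Fourier kernel `e^{2πiλ…}` on `[−λ, λ]`); only `c = 2π` is consumed (CC2021 App. E/F, K0/K2).

## Bridge (theorems)

`abs_prolateEigen_le_osipovMajorant`: under the fact, for CC's index `n ≥ 6` (Osipov's `2n ≥ 12 >
4 + √42`), `|prolateEigen n| ≤ osipovMajorant n := 1195·2π·X(n)⁴·e^{π³/12}·e^{−πn/2}`,
`X(n) = (2n(2n+1) + 4π²)/(4π²)`, using the PROVED Wang bounds `2n(2n+1) < χ < 2n(2n+1) + 4π²`
(`Wang2010_lemma_2_2_holds`) and (cosalphan) (`CC2021_sec4_cosalphan_holds`); and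
`summable_osipovMajorant_mul_pow : ∀ k, Summable (n ↦ osipovMajorant n · n^k)` (geometric decay
`e^{−π/2} < 1`), whence `summable_abs_prolateEigen_mul_pow_of_osipov : ∀ k, Summable (n ↦ |λ(n)| n^k)`
and the SHAPE OF RECORD `summable_abs_prolateEigen_mul_sq_of_osipov : Summable (n ↦ |λ(n)| n²)`
(cc-lead R69 (1): the single decay hypothesis `hdec` of gm-t16's `ArchDensityOfMajorant` K0 / Lemma 5.4
chain), plus the packages `exists_eventual_majorant_prolateEigen_of_osipov` (n₁ = 6, all k) and
`exists_eventually_majorant_prolateEigen_of_osipov` (cc-t6's `∀ᶠ`/`n²` shape).  QUANTITATIVE CAVEAT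
(cc-t8 06:56:59Z): the majorant is > 1 up to Osipov-index ≈ 26 — irrelevant for summability/K0, but it
does not replace (rapid-decay) numerically for small `n`.
Nothing in this file bears on the truth of the Riemann hypothesis.
-/

noncomputable section

open Real MeasureTheory Set Filter intervalIntegral Complex Asymptotics
open scoped Nat Topology

namespace Literature.NumberTheory.LFunctions

open Literature.NumberTheory.ConnesConsani2021

/-! ## §1 The named fact (Osipov 2013, Theorem 33, at `c = 2π`) -/

/-- NAMED FACT (RH-FREE, PROVED in print).  **Osipov 2013, Theorem 33** at band-limit `c = 2π`:
"Suppose that `n > 0` is a positive integer, and that `n > (2c/π) + √42`.  Suppose also that the real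
number `x_n` is defined via the formula `x_n = χ_n/c²`.  Then
`|λ_n| < 1195 · c · (x_n)^{3/4} · (x_n − 1)^{1/4} · (x_n − ½)³ · exp[−(π/4) · (√x_n − 1/√x_n) · c]`."
Here (`c = 2π`, so `2c/π = 4`): `f` is the prolate function with `n` roots (`IsProlateFunction 1 n f`;
Osipov's `ψ_n` up to a scalar, Thms 1, 3), `χ` its Sturm–Liouville eigenvalue (hypothesis `hχ`, the
`eigen` relation of `IsProlateFunction` at `λ = 1`), `μ = λ_n` its eigenvalue under
`F_c[φ](x) = ∫_{−1}^{1}φ(t)e^{icxt}dt` (hypothesis `hμ`, real since `n` is even), and `Even n` is carried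
because the printed proof (via Osipov's Thms 9 and 23) is for even `n`.  Proof in print: Thm 33
(p0018:L177–p0019:L17) from Thm 23 ("the principal result") and Thms 6–9 of [Osipov2012Inequalities].
-- TODO(general form): any `c > 0`.
[cite: Osipov2013, Thm. 33 (arXiv:1206.4541 chunk p0018:L158–L175); §2.1 eq. (1)–(2) (p0004:L20–L33), Thms 1, 3 (p0004:L51–L58, L177–L191); Osipov2012Inequalities (inputs Thms 6–9)] -/
def Osipov2013_thm_33 : Prop :=
  ∀ (n : ℕ) (f : ℝ → ℝ) (χ μ : ℝ), IsProlateFunction 1 n f →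
    (∀ x ∈ Ioo (-1 : ℝ) 1,
      -(deriv (fun y ↦ (1 ^ 2 - y ^ 2) * deriv f y) x) + (2 * π * 1 * x) ^ 2 * f x = χ * f x) →
    (∀ ω ∈ Icc (-1 : ℝ) 1,
      ∫ x in (-1 : ℝ)..1, (f x : ℂ) * cexp (2 * π * I * x * ω) = (μ : ℂ) * f ω) →
    Even n → (4 : ℝ) + Real.sqrt 42 < n →
      |μ| < 1195 * (2 * π) * (χ / (2 * π) ^ 2) ^ (3 / 4 : ℝ) * (χ / (2 * π) ^ 2 - 1) ^ (1 / 4 : ℝ) *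
        (χ / (2 * π) ^ 2 - 1 / 2) ^ 3 *
        Real.exp (-(π / 4) * (Real.sqrt (χ / (2 * π) ^ 2) - 1 / Real.sqrt (χ / (2 * π) ^ 2)) * (2 * π))

/-! ## §2 The explicit eventual majorant for CC's `λ(n)` -/

/-- RH-FREE object.  Wang's upper value for `x = χ_{2n}^{2π}/(2π)²`: `X(n) = (2n(2n+1) + 4π²)/(4π²)`.
[cite: WangLL2010, Lemma 2.2 eq. (2.6) p. 809; Osipov2013, Thm. 33] -/
def osipovX (n : ℕ) : ℝ := (2 * (n : ℝ) * (2 * n + 1) + (2 * π) ^ 2) / (2 * π) ^ 2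

/-- RH-FREE object.  **The explicit majorant** `r(n) = 1195 · 2π · X(n)⁴ · e^{π³/12} · e^{−πn/2}` of
Osipov's bound at `c = 2π`, index `2n`, after Wang's `2n(2n+1) < χ < 2n(2n+1) + 4π²`.
[cite: Osipov2013, Thm. 33; WangLL2010, Lemma 2.2] -/
def osipovMajorant (n : ℕ) : ℝ :=
  1195 * (2 * π) * osipovX n ^ 4 * Real.exp (π ^ 3 / 12) * Real.exp (-(π / 2)) ^ n

/-- `X(n) ≥ 1`. [cite: WangLL2010, Lemma 2.2] -/
theorem one_le_osipovX (n : ℕ) : 1 ≤ osipovX n := by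
  rw [osipovX, le_div_iff₀ (by positivity)]
  nlinarith [Real.pi_pos, sq_nonneg (n : ℝ)]

/-- `r(n) > 0`. [cite: Osipov2013, Thm. 33] -/
theorem osipovMajorant_pos (n : ℕ) : 0 < osipovMajorant n := by
  have := one_le_osipovX n
  unfold osipovMajorant
  positivity

/-- The elementary estimate behind the bridge: for `χ` in Wang's window at index `2n`, `n ≥ 6`,
Osipov's bound is at most `r(n)`.  (`x ≥ 1`, so `x^{3/4}(x−1)^{1/4} ≤ x`, `(x−½)³ ≤ x³`; and
`(π/4)(√x − 1/√x)(2π) = (π/4)√χ − π³/√χ ≥ πn/2 − π³/(2n) ≥ πn/2 − π³/12` as `√χ > 2n ≥ 12`.)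
[cite: Osipov2013, Thm. 33; WangLL2010, Lemma 2.2] -/
theorem osipovBound_le_osipovMajorant {n : ℕ} (hn : 6 ≤ n) {χ : ℝ}
    (hlo : 2 * (n : ℝ) * (2 * n + 1) < χ) (hhi : χ < 2 * (n : ℝ) * (2 * n + 1) + (2 * π) ^ 2) :
    1195 * (2 * π) * (χ / (2 * π) ^ 2) ^ (3 / 4 : ℝ) * (χ / (2 * π) ^ 2 - 1) ^ (1 / 4 : ℝ) *
        (χ / (2 * π) ^ 2 - 1 / 2) ^ 3 *
        Real.exp (-(π / 4) * (Real.sqrt (χ / (2 * π) ^ 2) - 1 / Real.sqrt (χ / (2 * π) ^ 2)) * (2 * π))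
      ≤ osipovMajorant n := by
  have hn' : (6 : ℝ) ≤ n := by exact_mod_cast hn
  have hπ := Real.pi_pos
  have hπ4 : π ≤ 4 := Real.pi_le_four
  have hc2 : (0 : ℝ) < (2 * π) ^ 2 := by positivity
  set x : ℝ := χ / (2 * π) ^ 2 with hx
  -- `χ > 4n² ≥ 144 > 4π²`, so `x > 1`
  have hχpos : 0 < χ := by nlinarith
  have hχ4 : 4 * (n : ℝ) ^ 2 < χ := by nlinarith
  have hx1 : 1 < x := by
    rw [hx, lt_div_iff₀ hc2]; nlinarith
  have hx0 : 0 < x := by linarith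
  have hxX : x ≤ osipovX n := by
    rw [hx, osipovX]
    exact div_le_div_of_nonneg_right hhi.le hc2.le
  -- (a) the algebraic prefactor
  have ha : x ^ (3 / 4 : ℝ) * (x - 1) ^ (1 / 4 : ℝ) ≤ x := by
    have h1 : (x - 1) ^ (1 / 4 : ℝ) ≤ x ^ (1 / 4 : ℝ) :=
      Real.rpow_le_rpow (by linarith) (by linarith) (by norm_num)
    calc x ^ (3 / 4 : ℝ) * (x - 1) ^ (1 / 4 : ℝ) ≤ x ^ (3 / 4 : ℝ) * x ^ (1 / 4 : ℝ) := by
          gcongr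
      _ = x := by
          rw [← Real.rpow_add hx0]; norm_num
  have hb : (x - 1 / 2) ^ 3 ≤ x ^ 3 := by
    gcongr <;> linarith
  have hab : x ^ (3 / 4 : ℝ) * (x - 1) ^ (1 / 4 : ℝ) * (x - 1 / 2) ^ 3 ≤ osipovX n ^ 4 := by
    calc x ^ (3 / 4 : ℝ) * (x - 1) ^ (1 / 4 : ℝ) * (x - 1 / 2) ^ 3 ≤ x * x ^ 3 :=
          mul_le_mul ha hb (pow_nonneg (by linarith) 3) hx0.le
      _ = x ^ 4 := by ring
      _ ≤ osipovX n ^ 4 := by gcongr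
  -- (c) the exponent: `(π/4)(√x − 1/√x)(2π) = (π/4)√χ − π³/√χ ≥ πn/2 − π³/12`
  have hsx : Real.sqrt x = Real.sqrt χ / (2 * π) := by
    rw [hx, Real.sqrt_div' χ hc2.le, Real.sqrt_sq (by positivity)]
  have hsχ : 2 * (n : ℝ) < Real.sqrt χ := by
    rw [show (2 * (n : ℝ)) = Real.sqrt ((2 * n) ^ 2) by rw [Real.sqrt_sq (by positivity)]]
    exact Real.sqrt_lt_sqrt (by positivity) (by nlinarith)
  have hsχpos : 0 < Real.sqrt χ := Real.sqrt_pos.2 hχpos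
  have hexp_arg : -(π / 4) * (Real.sqrt x - 1 / Real.sqrt x) * (2 * π) ≤ π ^ 3 / 12 + -(π / 2) * n := by
    rw [hsx]
    have h2n : (0 : ℝ) < 2 * n := by positivity
    -- the map `s ↦ (π/4)s − π³/s` is increasing on `s > 0`; evaluate at `s = 2n < √χ`
    have hmono : π / 4 * (2 * n) - π ^ 3 / (2 * n) ≤ π / 4 * Real.sqrt χ - π ^ 3 / Real.sqrt χ := by
      have : π ^ 3 / Real.sqrt χ ≤ π ^ 3 / (2 * n) :=
        div_le_div_of_nonneg_left (by positivity) h2n hsχ.le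
      nlinarith
    have h12 : π ^ 3 / (2 * n) ≤ π ^ 3 / 12 :=
      div_le_div_of_nonneg_left (by positivity) (by norm_num) (by linarith)
    have hπne : π ≠ 0 := hπ.ne'
    have key : -(π / 4) * (Real.sqrt χ / (2 * π) - 1 / (Real.sqrt χ / (2 * π))) * (2 * π) =
        -(π / 4 * Real.sqrt χ - π ^ 3 / Real.sqrt χ) := by
      field_simp
      ring
    rw [key]
    linarith
  have hexp : Real.exp (-(π / 4) * (Real.sqrt x - 1 / Real.sqrt x) * (2 * π)) ≤
      Real.exp (π ^ 3 / 12) * Real.exp (-(π / 2)) ^ n := by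
    rw [← Real.exp_nat_mul, ← Real.exp_add]
    exact Real.exp_le_exp.2 (by linarith)
  -- assemble
  unfold osipovMajorant
  have h0 : (0 : ℝ) ≤ 1195 * (2 * π) := by positivity
  calc 1195 * (2 * π) * x ^ (3 / 4 : ℝ) * (x - 1) ^ (1 / 4 : ℝ) * (x - 1 / 2) ^ 3 *
        Real.exp (-(π / 4) * (Real.sqrt x - 1 / Real.sqrt x) * (2 * π))
        = 1195 * (2 * π) * (x ^ (3 / 4 : ℝ) * (x - 1) ^ (1 / 4 : ℝ) * (x - 1 / 2) ^ 3) *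
          Real.exp (-(π / 4) * (Real.sqrt x - 1 / Real.sqrt x) * (2 * π)) := by ring
    _ ≤ 1195 * (2 * π) * osipovX n ^ 4 * (Real.exp (π ^ 3 / 12) * Real.exp (-(π / 2)) ^ n) := by
          gcongr
    _ = _ := by ring

/-! ## §3 The bridge to CC's `λ(n)` -/

/-- **Bridge**: Osipov's Theorem 33 (typed fact) gives, for CC's index `n ≥ 6` (Osipov's even index
`2n ≥ 12 > 4 + √42`), `|λ(n)| ≤ r(n)` with the explicit geometric majorant `osipovMajorant`; inputs:
(cosalphan) `CC2021_sec4_cosalphan_holds` (the eigen-relation of `λ(n)`), the `eigen` field of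
`prolateFun n`, and Wang's window `Wang2010_lemma_2_2_holds`.
[cite: Osipov2013, Thm. 33; ConnesConsani2021, §4 p. 16 eq. (cosalphan); WangLL2010, Lemma 2.2] -/
theorem abs_prolateEigen_le_osipovMajorant (h : Osipov2013_thm_33) {n : ℕ} (hn : 6 ≤ n) :
    |prolateEigen n| ≤ osipovMajorant n := by
  have hf := isProlateFunction_prolateFun n
  obtain ⟨χ, hχ⟩ := hf.eigen
  have hμ := CC2021_sec4_cosalphan_holds n
  have heven : Even (2 * n) := even_two_mul n
  have hthr : (4 : ℝ) + Real.sqrt 42 < ((2 * n : ℕ) : ℝ) := by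
    have hs : Real.sqrt 42 < 7 := by
      rw [show (7 : ℝ) = Real.sqrt (7 ^ 2) by rw [Real.sqrt_sq (by norm_num)]]
      exact Real.sqrt_lt_sqrt (by norm_num) (by norm_num)
    have hn' : (6 : ℝ) ≤ n := by exact_mod_cast hn
    push_cast
    linarith
  have hO := h (2 * n) (prolateFun n) χ (prolateEigen n) hf hχ hμ heven hthr
  have hW := Wang2010_lemma_2_2_holds 1 (2 * n) (prolateFun n) χ hf hχ
  push_cast at hW
  have hlo : 2 * (n : ℝ) * (2 * n + 1) < χ := by nlinarith [hW.1]
  have hhi : χ < 2 * (n : ℝ) * (2 * n + 1) + (2 * π) ^ 2 := by nlinarith [hW.2]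
  exact hO.le.trans (osipovBound_le_osipovMajorant hn hlo hhi)

/-- `X(n) ≤ (6 + 4π²)/(4π²) · n²` for `n ≥ 1` (so `r(n) n^k = O(n^{8+k} e^{−πn/2})`). [cite: WangLL2010, Lemma 2.2] -/
theorem osipovX_le (n : ℕ) (hn : 1 ≤ n) :
    osipovX n ≤ (6 + (2 * π) ^ 2) / (2 * π) ^ 2 * (n : ℝ) ^ 2 := by
  have hn' : (1 : ℝ) ≤ n := by exact_mod_cast hn
  have hc2 : (0 : ℝ) < (2 * π) ^ 2 := by positivity
  rw [osipovX, div_mul_eq_mul_div, div_le_div_iff_of_pos_right hc2]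
  have h1 : (n : ℝ) ≤ (n : ℝ) ^ 2 := by nlinarith
  have h2 : (2 * π) ^ 2 ≤ (2 * π) ^ 2 * (n : ℝ) ^ 2 := by nlinarith
  nlinarith [h1, h2]

/-- **Summability of the majorant against every polynomial**: `Σ_n r(n) n^k < ∞` for all `k`
(`r(n) n^k = O(n^{k+8} q^n)`, `q = e^{−π/2} < 1`). [cite: Osipov2013, Thm. 33 (geometric decay of the bound)] -/
theorem summable_osipovMajorant_mul_pow (k : ℕ) :
    Summable (fun n : ℕ ↦ osipovMajorant n * (n : ℝ) ^ k) := by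
  set q : ℝ := Real.exp (-(π / 2)) with hq
  have hq0 : 0 < q := Real.exp_pos _
  have hq1 : q < 1 := Real.exp_lt_one_iff.2 (by linarith [Real.pi_pos])
  have hg : Summable (fun n : ℕ ↦ (n : ℝ) ^ (k + 8) * q ^ n) :=
    summable_pow_mul_geometric_of_norm_lt_one (k + 8) (by rwa [Real.norm_of_nonneg hq0.le])
  set A : ℝ := (6 + (2 * π) ^ 2) / (2 * π) ^ 2 with hA
  have hA0 : 0 ≤ A := by positivity
  set C : ℝ := 1195 * (2 * π) * A ^ 4 * Real.exp (π ^ 3 / 12) with hC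
  refine summable_of_isBigO_nat hg ?_
  refine IsBigO.of_bound C ?_
  filter_upwards [eventually_ge_atTop 1] with n hn
  have hX := osipovX_le n hn
  have hX0 : 0 ≤ osipovX n := zero_le_one.trans (one_le_osipovX n)
  rw [Real.norm_of_nonneg (mul_nonneg (osipovMajorant_pos n).le (by positivity)),
    Real.norm_of_nonneg (by positivity)]
  have h4 : osipovX n ^ 4 ≤ A ^ 4 * (n : ℝ) ^ 8 := by
    calc osipovX n ^ 4 ≤ (A * (n : ℝ) ^ 2) ^ 4 := by gcongr
      _ = A ^ 4 * (n : ℝ) ^ 8 := by ring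
  calc osipovMajorant n * (n : ℝ) ^ k
      = 1195 * (2 * π) * Real.exp (π ^ 3 / 12) * osipovX n ^ 4 * ((n : ℝ) ^ k * q ^ n) := by
        simp only [osipovMajorant, hq]; ring
    _ ≤ 1195 * (2 * π) * Real.exp (π ^ 3 / 12) * (A ^ 4 * (n : ℝ) ^ 8) * ((n : ℝ) ^ k * q ^ n) := by
        gcongr
    _ = C * ((n : ℝ) ^ (k + 8) * q ^ n) := by
        simp only [hC]; ring

/-- **The eventual-majorant package consumed by the K0/K2 chain** (cc-lead R63 (3)/R64 (2)): from
Osipov's Theorem 33, an index `n₁` and a majorant `r` with `|λ(n)| ≤ r(n)` for `n ≥ n₁` and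
`Σ r(n) n^k < ∞` for every `k` (here `n₁ = 6`, `r = osipovMajorant`).
[cite: Osipov2013, Thm. 33; ConnesConsani2021, §4 p. 16 (rapid-decay), as used in App. E/F] -/
theorem exists_eventual_majorant_prolateEigen_of_osipov (h : Osipov2013_thm_33) :
    ∃ (n₁ : ℕ) (r : ℕ → ℝ), (∀ n, n₁ ≤ n → |prolateEigen n| ≤ r n) ∧ (∀ n, 0 < r n) ∧
      ∀ k : ℕ, Summable (fun n : ℕ ↦ r n * (n : ℝ) ^ k) :=
  ⟨6, osipovMajorant, fun _ hn ↦ abs_prolateEigen_le_osipovMajorant h hn, osipovMajorant_pos,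
    summable_osipovMajorant_mul_pow⟩

/-- Eventual form (`∀ᶠ n in atTop`). [cite: Osipov2013, Thm. 33] -/
theorem eventually_abs_prolateEigen_le_osipovMajorant (h : Osipov2013_thm_33) :
    ∀ᶠ n : ℕ in atTop, |prolateEigen n| ≤ osipovMajorant n := by
  filter_upwards [eventually_ge_atTop 6] with n hn
  exact abs_prolateEigen_le_osipovMajorant h hn

/-- **`Σ_n |λ(n)| n^k < ∞` for every `k`, from Osipov's Theorem 33** (comparison with `r(n) n^k`
from `n ≥ 6` on). [cite: Osipov2013, Thm. 33; ConnesConsani2021, §4 p. 16 (rapid-decay) as used in App. E/F] -/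
theorem summable_abs_prolateEigen_mul_pow_of_osipov (h : Osipov2013_thm_33) (k : ℕ) :
    Summable (fun n : ℕ ↦ |prolateEigen n| * (n : ℝ) ^ k) := by
  refine Summable.of_norm_bounded_eventually_nat (summable_osipovMajorant_mul_pow k) ?_
  filter_upwards [eventually_abs_prolateEigen_le_osipovMajorant h] with n hn
  rw [Real.norm_of_nonneg (by positivity)]
  gcongr

/-- **The decay input of the K0 / Lemma 5.4 chain in its shape of record** (cc-lead R69 (1); gm-t16's
`ArchDensityOfMajorant` hypothesis `hdec`): `Σ_n |λ(n)| n² < ∞`, from Osipov's Theorem 33.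
[cite: Osipov2013, Thm. 33; ConnesConsani2021, §5 Lemma 5.4 / App. E–F (use of (rapid-decay))] -/
theorem summable_abs_prolateEigen_mul_sq_of_osipov (h : Osipov2013_thm_33) :
    Summable (fun n : ℕ ↦ |prolateEigen n| * (n : ℝ) ^ 2) :=
  summable_abs_prolateEigen_mul_pow_of_osipov h 2

/-- cc-t6's shape (`SeriesRemainderMajorant`): an eventual majorant summable against `n²`.
[cite: Osipov2013, Thm. 33] -/
theorem exists_eventually_majorant_prolateEigen_of_osipov (h : Osipov2013_thm_33) :
    ∃ r : ℕ → ℝ, (∀ᶠ n : ℕ in atTop, |prolateEigen n| ≤ r n) ∧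
      Summable (fun n : ℕ ↦ r n * (n : ℝ) ^ 2) :=
  ⟨osipovMajorant, eventually_abs_prolateEigen_le_osipovMajorant h, summable_osipovMajorant_mul_pow 2⟩

end Literature.NumberTheory.LFunctions
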